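import Mathlib.GroupTheory.FiniteAbelian.Basic
import Mathlib.Algebra.DirectSum.Module
import Summits.MatrixMultiplication.OmegaCensus.DihedralLikeFamily
import HarnessLib

/-!
# `3 ∣ |A|`: every dihedral-like group over `A` attains `β = 8|A|/3` (hypothesis-free form)

ω-census, family (b3).  Framing: lottery ticket; floor = certified bounds/negative ranges.

`DihedralLikeFamily.dihedralLike_law_exact` gives `β(G) = 4⌊2|A|/3⌋ = 8|A|/3` for a dihedral-like group over `A` GIVEN a
homomorphism `φ : A →+ ZMod 3` with a non-zero value.  Such a `φ` exists exactly when `3 ∣ |A|`; this file supplies it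
(`exists_addMonoidHom_zmod_three`, from the structure theorem of finite abelian groups: `A ≃+ ⨁ ℤ/nᵢ`, and `3 ∣ ∏ nᵢ` puts a `3`
in some `nᵢ`, whence `ℤ/nᵢ ↠ ℤ/3`), so that **for every finite abelian `A` with `3 ∣ |A|` and every `c₀` (`2c₀ = 0`), the
dihedral-like group `G(A, c₀)` attains `|S||T||U| = 8|A|/3 = 4⌊|G|/3⌋`** (`dihedralLike_law_exact_of_three_dvd`) — the
`|A| ≡ 0 (mod 3)` row of the census's law table, now unconditional.
-/

namespace Summit.MatrixMultiplication.OmegaCensus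

open Literature.Combinatorics.Additive Finset
open scoped DirectSum

/-- **A finite abelian group of order divisible by `3` maps onto `ℤ/3`**: there is `φ : A →+ ZMod 3` with a non-zero value.
[folklore] -/
theorem exists_addMonoidHom_zmod_three {A : Type} [AddCommGroup A] [Fintype A] (h3 : 3 ∣ Fintype.card A) :
    ∃ φ : A →+ ZMod 3, ∃ d : A, φ d ≠ 0 := by
  classical
  obtain ⟨ι, _, n, hn, ⟨e⟩⟩ := AddCommGroup.equiv_directSum_zmod_of_finite' A
  -- `|A| = ∏ nᵢ`
  haveI : ∀ i, NeZero (n i) := fun i => ⟨by have := hn i; omega⟩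
  have hcard : Fintype.card A = ∏ i, n i := by
    rw [Fintype.card_congr (e.toEquiv.trans (DirectSum.linearEquivFunOnFintype ℤ ι (fun i => ZMod (n i))).toEquiv),
      Fintype.card_pi]
    exact Finset.prod_congr rfl fun i _ => ZMod.card (n i)
  rw [hcard] at h3
  obtain ⟨i, -, hi⟩ := (Prime.dvd_finsetProd_iff Nat.prime_three.prime _).1 h3
  -- `φ = (ℤ/nᵢ ↠ ℤ/3) ∘ (projection to the i-th summand) ∘ e`
  let π : (⨁ j, ZMod (n j)) →+ ZMod (n i) := (DirectSum.component ℤ ι (fun j => ZMod (n j)) i).toAddMonoidHom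
  let φ : A →+ ZMod 3 := ((ZMod.castHom hi (ZMod 3)).toAddMonoidHom.comp π).comp e.toAddMonoidHom
  refine ⟨φ, e.symm (DirectSum.lof ℤ ι (fun j => ZMod (n j)) i 1), ?_⟩
  show (ZMod.castHom hi (ZMod 3)) (π (e (e.symm _))) ≠ 0
  rw [e.apply_symm_apply]
  show (ZMod.castHom hi (ZMod 3)) (DirectSum.component ℤ ι (fun j => ZMod (n j)) i (DirectSum.lof ℤ ι _ i 1)) ≠ 0
  rw [DirectSum.component.lof_self, map_one]
  exact one_ne_zero

section DihedralLike

variable {A : Type} [AddCommGroup A] [DecidableEq A] [Fintype A] {G : Type} [Group G] [DecidableEq G]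
  {ρ τ : A → G} {c₀ : A}

/-- **`3 ∣ |A|` ⇒ `β(G) = 8|A|/3` exactly, for every dihedral-like `G` over `A`** (any `c₀`): the law `4⌊2|A|/3⌋` holds and
is attained by the index-3 family. [folklore] -/
theorem dihedralLike_law_exact_of_three_dvd [Fintype G] (hρρ : ∀ a b, ρ a * ρ b = ρ (a + b))
    (hρτ : ∀ a b, ρ a * τ b = τ (b - a)) (hτρ : ∀ a b, τ a * ρ b = τ (a + b))
    (hττ : ∀ a b, τ a * τ b = ρ (c₀ + b - a)) (hρ : Function.Injective ρ) (hτ : Function.Injective τ)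
    (hne : ∀ a b, ρ a ≠ τ b) (hsurj : ∀ g, (∃ a, ρ a = g) ∨ (∃ a, τ a = g)) (h3 : 3 ∣ Fintype.card A) :
    (∀ S T U : Finset G, TripleProductProperty S T U → S.card * T.card * U.card ≤ 4 * (2 * Fintype.card A / 3)) ∧
    ∃ S T U : Finset G, TripleProductProperty S T U ∧ S.card * T.card * U.card = 4 * (2 * Fintype.card A / 3) := by
  obtain ⟨φ, d, hd⟩ := exists_addMonoidHom_zmod_three h3
  exact dihedralLike_law_exact hρρ hρτ hτρ hττ hρ hτ hne hsurj φ d hd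

end DihedralLike

end Summit.MatrixMultiplication.OmegaCensus
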